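import Summits.MatrixMultiplication.MatrixMultiplication.Theorems.SoloInformedTwistedMatchingsAbelian
import Summits.MatrixMultiplication.MatrixMultiplication.Theorems.SoloInformedTwistedMatchingsCoprime
import HarnessLib

/-!
# Twisted matchings in `(∏ ℤ/p^{e_i}) × T`, `p ∤ |T|`: the `p'`-part only costs its cardinality

Solo-informed seat (MatrixMultiplication), gen 101. Combining the explicit `p`-central generating
system of `A = ∏_i ℤ/p^{e_i}` with End-stable levels (`exists_prodZMod_levelPCGS`) with the
coprime-product reduction (`card_le_of_coprimeTwistedMatching`):
`exists_coprimeTwistedMatching_card_le` — for every prime `p` and `E` there is `δ = δ(p,E) > 0`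
such that for every finite group `S ≅ A × T`, `A = ∏_i ℤ/p^{e_i}` with `e_i ≤ E`, `T` ANY finite
group of order prime to `p`, every finite family of automorphism pairs `(φ_s, ψ_s)` of `S` and every
family `(x_i, y_i, z_i)_{i ∈ ι}` with `(∃ s, x_i φ_s(y_j) ψ_s(z_l) = 1) ⟺ i = j = l`:
`|ι| ≤ 3 · |T| · |A|^{1-δ} = 3 |S| · |A|^{-δ}`.
For a finite abelian group of exponent `m` and its largest Sylow subgroup `A = S_p`
(`|S_p| ≥ |S|^{1/ω(m)}`) this is `|ι| ≤ 3 |S|^{1 - δ/ω(m)}`: clause (c) of the seat's Theorem B″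
(sharpest-statement §2y(8)) for all abelian hosts of bounded exponent.
References: BlasiakChurchCohnGrochowUmans2017 (arXiv:1712.02302) Prop. 3.2, Lemma 3.21,
Thm. 3.11; CohnUmans2013 (arXiv:1207.6528) Def. 12, §5, Conj. 21.
-/

noncomputable section

open scoped BigOperators
open Finset Literature.Combinatorics.Additive Literature.Barriers.MatrixMultiplication

namespace Summit.MatrixMultiplication.MatrixMultiplication.Theorems.TwistedSliceRank

section Sylow

/-- **Twisted matchings in `(∏ ℤ/p^{e_i}) × T` with `p ∤ |T|`.** For every prime `p` and every
`E` there is `δ > 0` such that: if `S ≅ A × T` with `A = ∏_{i ∈ κ} ℤ/n_i`, `n_i = p^{e_i}`,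
`e_i ≤ E`, and `T` a finite group with `gcd(p, |T|) = 1`, then every family
`(x_i, y_i, z_i)_{i ∈ ι}` in `S` with `(∃ s, x_i · φ_s(y_j) · ψ_s(z_l) = 1) ⟺ i = j = l` for a
finite family of automorphism pairs `(φ_s, ψ_s)` of `S` has `|ι| ≤ 3 · |T| · |A|^{1-δ}`.
[this work] -/
theorem exists_coprimeTwistedMatching_card_le (p : ℕ) [hp : Fact p.Prime] (E : ℕ) :
    ∃ δ : ℝ, 0 < δ ∧ ∀ (κ : Type) [Fintype κ] [DecidableEq κ] (n e : κ → ℕ)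
      [∀ i, NeZero (n i)], (∀ i, n i = p ^ e i) → (∀ i, e i ≤ E) →
      ∀ (T : Type) [Group T] [Fintype T] [DecidableEq T], Nat.Coprime p (Fintype.card T) →
      ∀ (S : Type) [Group S] [Fintype S] [DecidableEq S]
        (eS : S ≃* (((i : κ) → Multiplicative (ZMod (n i))) × T))
        (σ : Type) [Fintype σ] (φ ψ : σ → S ≃* S) (ι : Type) [Fintype ι] (x y z : ι → S),
      (∀ i j l : ι, (∃ s : σ, x i * φ s (y j) * ψ s (z l) = 1) ↔ (i = j ∧ j = l)) →
      (Fintype.card ι : ℝ) ≤ 3 * (Fintype.card T : ℝ) *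
        (Fintype.card ((i : κ) → Multiplicative (ZMod (n i))) : ℝ) ^ (1 - δ) := by
  classical
  have hp2 : 2 ≤ p := hp.out.two_le
  obtain ⟨ρ, hρ0, hρ1, hdecay⟩ :=
    exists_tail_decay hp2 (Wmax := (p + 1) ^ (E - 1)) (Nat.one_le_pow _ _ (Nat.succ_pos p))
  have hp1 : (1 : ℝ) < p := by exact_mod_cast hp.out.one_lt
  have hlogp : 0 < Real.log p := Real.log_pos hp1
  have hlogρ : Real.log ρ < 0 := Real.log_neg hρ0 hρ1
  set δ : ℝ := -Real.log ρ / Real.log p with hδ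
  have hδ0 : 0 < δ := by rw [hδ]; exact div_pos (by linarith) hlogp
  refine ⟨δ, hδ0, ?_⟩
  intro κ _ _ n e _ hne heE T _ _ _ hT S _ _ _ eS σ _ φ ψ ι _ x y z hmatch
  obtain ⟨ιA, _, _, C, hCL, hS'⟩ := exists_prodZMod_levelPCGS (p := p) (n := n) (e := e) hne heE
  -- transport the matching along `eS`
  let φ' := fun s => (eS.symm.trans (φ s)).trans eS
  let ψ' := fun s => (eS.symm.trans (ψ s)).trans eS
  have hrel : ∀ (i j l : ι) (s : σ),
      eS (x i) * φ' s (eS (y j)) * ψ' s (eS (z l)) = 1 ↔ x i * φ s (y j) * ψ s (z l) = 1 := by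
    intro i j l s
    simp only [φ', ψ', MulEquiv.trans_apply, MulEquiv.symm_apply_apply]
    rw [← map_mul, ← map_mul, eS.map_eq_one_iff]
  have hmatch' : ∀ i j l : ι,
      (∃ s : σ, eS (x i) * φ' s (eS (y j)) * ψ' s (eS (z l)) = 1) ↔ (i = j ∧ j = l) := by
    intro i j l
    simp_rw [hrel]
    exact hmatch i j l
  -- the field and the weights
  have hinj : Function.Injective
      (algebraMap (Polynomial (ZMod p)) (FractionRing (Polynomial (ZMod p)))) :=
    IsFractionRing.injective (Polynomial (ZMod p)) (FractionRing (Polynomial (ZMod p)))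
  haveI : CharP (FractionRing (Polynomial (ZMod p))) p := charP_of_injective_algebraMap hinj p
  haveI : Infinite (FractionRing (Polynomial (ZMod p))) := Infinite.of_injective _ hinj
  let Sol : ι → Finset σ := fun i => Finset.univ.filter fun s =>
    eS (x i) * φ' s (eS (y i)) * ψ' s (eS (z i)) = 1
  have hSol : ∀ i, (Sol i).Nonempty := fun i => by
    obtain ⟨s, hs⟩ := (hmatch' i i i).2 ⟨rfl, rfl⟩
    exact ⟨s, by simp [Sol, hs]⟩
  obtain ⟨t, ht⟩ := exists_weights (K := FractionRing (Polynomial (ZMod p))) Sol hSol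
  have hdiag : ∀ i, (∑ s, t s * (if eS (x i) * φ' s (eS (y i)) * ψ' s (eS (z i)) = 1
      then (1 : FractionRing (Polynomial (ZMod p))) else 0)) ≠ 0 := by
    intro i
    have hsum : (∑ s, t s * (if eS (x i) * φ' s (eS (y i)) * ψ' s (eS (z i)) = 1
        then (1 : FractionRing (Polynomial (ZMod p))) else 0)) = ∑ s ∈ Sol i, t s := by
      rw [Finset.sum_filter]
      exact Finset.sum_congr rfl fun s _ => by split_ifs <;> simp
    rw [hsum]
    exact ht i
  -- weights are in `[1, (p+1)^{E-1}]`
  have hW1 : ∀ a : ιA, 1 ≤ C.W a := fun a => Nat.one_le_pow _ _ (Nat.succ_pos p)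
  have hW2 : ∀ a : ιA, C.W a ≤ (p + 1) ^ (E - 1) := by
    intro a
    show (p + 1) ^ C.lvl a ≤ (p + 1) ^ (E - 1)
    have h1 := C.lvl_lt a
    rw [hCL] at h1
    exact Nat.pow_le_pow_right (Nat.succ_pos p) (by omega)
  obtain ⟨tt, hlow, hhigh⟩ := hdecay ιA C.W hW1 hW2
  have hcard := card_le_of_coprimeTwistedMatching C (K := FractionRing (Polynomial (ZMod p)))
    hS' hT t φ' ψ' (fun i => eS (x i)) (fun i => eS (y i)) (fun i => eS (z i))
    (fun i j l s h => (hmatch' i j l).1 ⟨s, h⟩) hdiag tt tt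
  have hcard' : (Fintype.card ι : ℝ) ≤
      ((Fintype.card {ex : ιA → Fin p // ∑ a, (ex a : ℕ) * C.W a < tt} : ℝ) +
      (Fintype.card {ex : ιA → Fin p // ∑ a, (ex a : ℕ) * C.W a < tt} : ℝ) +
      (Fintype.card {ex : ιA → Fin p // tt + tt ≤ ∑ a, (ex a : ℕ) * C.W a} : ℝ)) *
      (Fintype.card T : ℝ) := by
    exact_mod_cast hcard
  -- `ρ^{|ιA|} p^{|ιA|} = |A|^{1-δ}`
  have hA : (Fintype.card ((i : κ) → Multiplicative (ZMod (n i))) : ℝ) =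
      (p : ℝ) ^ Fintype.card ιA := by
    rw [← Nat.card_eq_fintype_card, C.card_eq]; push_cast; rfl
  have hkey : ρ ^ Fintype.card ιA * (p : ℝ) ^ Fintype.card ιA =
      (Fintype.card ((i : κ) → Multiplicative (ZMod (n i))) : ℝ) ^ (1 - δ) := by
    rw [hA]
    have hp0 : (0 : ℝ) < p := by linarith
    have hρp : ρ = (p : ℝ) ^ (-δ) := by
      rw [Real.rpow_def_of_pos hp0, hδ]
      have : Real.log p * -(-Real.log ρ / Real.log p) = Real.log ρ := by field_simp
      rw [this, Real.exp_log hρ0]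
    rw [hρp, ← Real.rpow_natCast, ← Real.rpow_natCast, ← Real.rpow_mul hp0.le,
      ← Real.rpow_mul hp0.le, ← Real.rpow_add hp0]
    congr 1; ring
  have hT0 : (0 : ℝ) ≤ Fintype.card T := Nat.cast_nonneg _
  calc (Fintype.card ι : ℝ) ≤ _ := hcard'
    _ ≤ (ρ ^ Fintype.card ιA * (p : ℝ) ^ Fintype.card ιA +
        ρ ^ Fintype.card ιA * (p : ℝ) ^ Fintype.card ιA +
        ρ ^ Fintype.card ιA * (p : ℝ) ^ Fintype.card ιA) * (Fintype.card T : ℝ) := by gcongr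
    _ = 3 * (Fintype.card T : ℝ) *
        (Fintype.card ((i : κ) → Multiplicative (ZMod (n i))) : ℝ) ^ (1 - δ) := by
      rw [← hkey]; ring

end Sylow

end Summit.MatrixMultiplication.MatrixMultiplication.Theorems.TwistedSliceRank
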